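/-
Copyright (c) 2026 the pub-hodgecm-mathlib formalisation cell (harness21).  Prover seat hodgecm-mathlib-K2E1b-p13 (g0), Track B «K2-LIT» ∕ h413,
line K2_E1b «GKCohomologyU21», follow-on file #23: THE CARRIERS OF RECORD — Rogawski's §12.3 p. 178 table at `∞` with NAMED classes.
-/
import Summits.HodgeConjecture.HodgeConjecture.Theorems.K2E1bGKCohomologyU21Defs          -- ★ leaf #1: `centralExp`, `casimirExp`, `HasChiScalars`, `IsChiPinnedCohUnitary`, `NoDegOneClass`, `ArchPacketTable`
import Summits.HodgeConjecture.HodgeConjecture.Theorems.K2E1bDatumTwistActs               -- ★ #4 `DatumTwistActs`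
import Summits.HodgeConjecture.HodgeConjecture.Theorems.K2E1bKTypeTwistGK                 -- ★ #5 `kTypeRepTw`, `isGKModule_kTypeRepTw`, `kTypeRepTw_kvec_mem_span`
import Summits.HodgeConjecture.HodgeConjecture.Theorems.K2E1bTwistAdmissible              -- ★ #6 `twistAdmissible`
import Summits.HodgeConjecture.HodgeConjecture.Theorems.K2E1bTwistChiScalars              -- ★ #7 `twistChiScalars`
import Summits.HodgeConjecture.HodgeConjecture.Theorems.K2E1bTwistHermitian               -- ★ #8 `twistHermitian`
import Summits.HodgeConjecture.HodgeConjecture.Theorems.K2E1bTwistIrreducible             -- ★ #9 `TwistIrreducible`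
import Summits.HodgeConjecture.HodgeConjecture.Theorems.K2E1bJDatum                       -- ★ #11 `jDatum_plus`, `jDatum_minus`
import Summits.HodgeConjecture.HodgeConjecture.Theorems.K2E1bDsDatum                      -- ★ #12 ray lemmas, `ray_constraint_one`
import Summits.HodgeConjecture.HodgeConjecture.Theorems.K2E1bNoDegOneOfNoPTypes           -- ★ #14 `NoDegOneOfNoPTypes`
import Summits.HodgeConjecture.HodgeConjecture.Theorems.K2E1bTypeClassesBotTransport      -- ★ #15 `typeClassesBotTransport`
import Summits.HodgeConjecture.HodgeConjecture.Theorems.F0P3bStubT3aUnitaryAlongPOfHermitian  -- ★ T3a `stubT3aUnitaryAlongPOfHermitian_holds`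
import Summits.HodgeConjecture.HodgeConjecture.Theorems.K2E1bKovLieTwist                 -- ★ #3 `trace_coe_lie` (+ ★ `RealMatrixGroup.twistLie`)
import HarnessLib

/-!
# K2_E1b road (h413 = stmt-HodgeConjecture-24833), file #23 «CARRIERS OF RECORD»:
# the §12.3 p. 178 table at `∞` with NAMED data, NAMED `(𝔤, K)`-structures and NAMED classes — `tableOfRecord : ArchPacketTable`

Cell `pub/hodgecm-mathlib` (D-0151), Track B (21-frontier RULING «PUSH BOTH» 2026-09-03, director req621∕req624, chair K2-lead, dealer
K2E1b-plan).  Follow-on file #23 of the SIGS TABLE `K2/K2E1b-plan/g0/SIGS-TABLE-K2E1b.md`, dealt BY NAME 2026-09-03T21:30:48Z as «the BY-NAME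
EXPORT of R3 (a)»: the junction J1 (E1∕E4 archimedean character identities [Rogawski1990 Props. 12.3.2–12.3.3, Cor. 12.3.5]) must quantify over
THE SAME archimedean carriers for which the E1b clauses hold, and LEVEL A of the tier-0 line (`∃ jInf dsInf`, stubs «J-TABLE» ∕ «DS-TABLE» of
`Cruxes/H413/Lines/K2_E1b_GKCohomologyU21.lean`) only gives `Classical.choose` of ★ #11 ∕ #12.  This file fixes NAMES without claiming
identities (LEVEL B, the pin `[carrier] = archDegOneClass`, stays file #18):
* §1 DATA — `jDatumOfRecord s`, `dsDatumOfRecord s : SU21Datum` (`s = p + t`): the EXPLICIT Kovačević data [Kovacevic2021 §3] that ★ #11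
  `K2E1bJDatum.jDatum_plus ∕ jDatum_minus` and ★ #12 `K2E1bDsDatum.dsDatum` exhibit — the ladder rays `rayNE (2s+1) (−s)` (`+` case `s ≤ −1`,
  print's `J^+_φ|_{SU(2,1)}`) ∕ `raySE (−(2s+1)) (s+1)` (`−` case, `J^−_φ`), and the wall rays `raySE (−(2s+1)) 1` ∕ `rayNE (2s+1) 1` (`πˢ`; on
  the locus `D₀ ∕ D₂`) — an honest `if … then … else …` on print's case split `p + t ≤ −1` of ★ `ArchSignRecipe.rogTriple`, NO choice;
  `jDatumOfRecord_spec` ∕ `dsDatumOfRecord_spec` = the socket bodies of `sig_K2E1bJDatum` ∕ `sig_K2E1bDsDatum` WITH THE WITNESS NAMED.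
* §2 STRUCTURE — `traceCharacter z = z·tr : 𝔲(2,1) →ₗ⁅ℝ⁆ ℂ`, `σOfRecord 𝒟 e := twistLie (kovLie 𝒟.ρ) (traceCharacter (e∕3))` (the CENTRAL TWIST of
  record, ★ `GKModuleSubrepTwist.twistLie`; `IsTwistOf` holds by `rfl` — the witness of ★ #3) and `ρKOfRecord 𝒟 e := kTypeRepTw 𝒟.S e` (★ #5);
  for a datum integral at `e` they form a `(𝔤, K)`-module (★ #4 + #5), irreducible (★ #9), admissible (★ #6), unitary along `𝔭 ⊕ ℝz₀` (★ #8 +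
  ★ T3a) — `isCohUnitaryIrrep_ofRecord` — with χ-scalars `(κ₀ + e²∕3, e)` (★ #7) — `hasChiScalars_ofRecord`: ★ #10's packaging, witnesses named.
* §3 CLASSES — the bundles `jRepOfRecord`, `dsRepOfRecord p q t : GKIrrep G21`, their classes `jInfOfRecord`, `dsInfOfRecord : ℤ → ℤ → ℤ →
  GKIrrClass G21`, the χ-pins `jInfOfRecord_chi` ∕ `dsInfOfRecord_chi` at `(casimirExp, centralExp)`, the locus clause `dsInfOfRecord_locus`
  (on `φ = (1,0,−1)`: `e = 0`, so the twisted `𝔨`-formulas ARE ★ `ActsOnKTypes`; the wall ray has no `V_{2,±3}`, ★ #14 kills `H¹_{±1}`, ★ #15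
  transports `= ⊥` over the class) and **`tableOfRecord : ArchPacketTable`** (`.jInf = jInfOfRecord`, `.dsInf = dsInfOfRecord` by `rfl`).
WHAT IS NOT HERE (no double-booking): the tier-0 stubs `stub_jTable` ∕ `stub_dsTable` are the assemblies #20 (K2E1b-p08) ∕ #21 (K2E1b-p15),
one `exact ⟨jInfOfRecord, jInfOfRecord_chi⟩` away over this file; print's `D^∓_φ` off the locus is a QUADRANT datum of Kovačević's Thm. 3 —
LEVEL A (and this file) records the wall ray with the same `(κ, e)`-data and claims no identification.

HONEST LABEL: HC_CM is proved only modulo the 7 printed citations (2 remaining named inputs: hLiu418 = stmt-HodgeConjecture-24832,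
h413 = stmt-HodgeConjecture-24833) until rung 0 closes; this file is a `--supports stmt-HodgeConjecture-24833` helper (defs + theorems, no `sorry`,
no axiom, no instance declaration, no notation) and retires nothing by itself.

## References
* [Rogawski1990] J. Rogawski, *Automorphic Representations of Unitary Groups in Three Variables*, Ann. of Math. Stud. 123 (1990), §12.3
  pp. 176–178 (the packets `Π(φ)` at `∞`; the centre acts by the character of `F_φ`), Prop. 15.2.1 (a)(b) p. 249.
* [Kovacevic2021] D. Kovačević, *Unitary `(𝔤,K)` modules of `SU(2,1)`*, Acta Math. Spalatensia 1 (2021) 105–125, §3 Def. 1, Thm. 3; §4 Thm. 4–5.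
* [BorelWallach2000] A. Borel, N. Wallach, *Continuous cohomology, discrete subgroups, and representations of reductive groups*, 2nd ed., AMS
  (2000), 0 §2.5; I Thm. 5.3; VI 4.10–4.12.
* [KnappVogan1995] A. W. Knapp, D. A. Vogan, *Cohomological Induction and Unitary Representations*, Princeton (1995), §II.3 (2.38), Prop. 4.120.
-/

set_option autoImplicit false
set_option linter.dupNamespace false  -- the mandated namespace repeats the single-problem summit's segment

noncomputable section

open Literature.NumberTheory.Automorphic
open Literature.NumberTheory.Rogawski1990
open Literature.RepresentationTheory
open Literature.RepresentationTheory.BorelWallach2000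
open Literature.RepresentationTheory.KonnoKonno2007 Literature.RepresentationTheory.KonnoKonno2007.RealDualPair
open Literature.RepresentationTheory.KonnoKonno2007.RealDualPair.UForm
open Literature.RepresentationTheory.Kovacevic2021 Literature.RepresentationTheory.Kovacevic2021.SU21Datum
open Summit.HodgeConjecture.HodgeConjecture.Cruxes.H413.F0P3bLocalAPacketsDefs
open Summit.HodgeConjecture.HodgeConjecture.Cruxes.H413.F0P3bU21Restriction (kovLie)
open Summit.HodgeConjecture.HodgeConjecture.Cruxes.H413.F0P3bKTypeIntegration (KIdx kvec ActsOnKTypes)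
open Summit.HodgeConjecture.HodgeConjecture.Cruxes.H413.F0P3bArchDegOnePackage (IsCohUnitaryIrrep IsUnitaryAlongP)
open Summit.HodgeConjecture.HodgeConjecture.Cruxes.H413.F0P3bStubT3aUnitaryAlongPOfHermitian (stubT3aUnitaryAlongPOfHermitian_holds)
open Summit.HodgeConjecture.HodgeConjecture.Cruxes.H413.K2E1bGKCohomologyU21
open Summit.HodgeConjecture.HodgeConjecture.Cruxes.H413.K2E1bDatumTwistActs (DatumTwistActs)
open Summit.HodgeConjecture.HodgeConjecture.Cruxes.H413.K2E1bKTypeTwistGK (kTypeRepTw isGKModule_kTypeRepTw kTypeRepTw_kvec_mem_span)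
open Summit.HodgeConjecture.HodgeConjecture.Cruxes.H413.K2E1bTwistAdmissible (twistAdmissible)
open Summit.HodgeConjecture.HodgeConjecture.Cruxes.H413.K2E1bTwistChiScalars (twistChiScalars)
open Summit.HodgeConjecture.HodgeConjecture.Cruxes.H413.K2E1bTwistHermitian (twistHermitian)
open Summit.HodgeConjecture.HodgeConjecture.Cruxes.H413.K2E1bTwistIrreducible (TwistIrreducible)
open Summit.HodgeConjecture.HodgeConjecture.Cruxes.H413.K2E1bJDatum (jDatum_plus jDatum_minus)
open Summit.HodgeConjecture.HodgeConjecture.Cruxes.H413.K2E1bDsDatum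
open Summit.HodgeConjecture.HodgeConjecture.Cruxes.H413.K2E1bNoDegOneOfNoPTypes (NoDegOneOfNoPTypes)
open Summit.HodgeConjecture.HodgeConjecture.Cruxes.H413.K2E1bTypeClassesBotTransport (typeClassesBotTransport)

namespace Summit.HodgeConjecture.HodgeConjecture.Cruxes.H413.K2E1bCarriersOfRecord

-- Mathlib idiom (as in ★ `GKModules`, ★ `GKModuleSubrepTwist`, the ★ defs leaves): `ℂ`, `Module.End ℂ V` as Lie rings — needed to STATE `traceCharacter`, `σOfRecord`.
attribute [local instance 100] LieRing.ofAssociativeRing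

/-! ## §1  DATA — the Kovačević data of record at `s = p + t` -/

/-- **The `J`-carrier datum of record** at `s = p + t`: in the `+` case `s ≤ −1` (print's `n = 1`, `J^+_φ`) the north-east LADDER ray
`rayNE (2s+1) (−s)` (`K`-types `V_{n, 3n+2s+1}`, `n ≥ −s`; Kovačević's `Z(1−s)`), in the `−` case the south-east ladder ray
`raySE (−(2s+1)) (s+1)` (`V_{n, −3n+2s+1}`, `n ≥ s+1`; `Z(−(s+2))`) — the witnesses of ★ `jDatum_plus` ∕ `jDatum_minus`, chosen by `if`, no choice.
[cite: Rogawski1990, §12.3 p. 178] [cite: Kovacevic2021, §3 Thm. 3; §4 Thm. 4–5] -/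
def jDatumOfRecord (s : ℤ) : SU21Datum :=
  if h : s ≤ -1 then rayNE (2 * s + 1) (-s) (by omega) (by ring)
  else raySE (-(2 * s + 1)) (s + 1) (by omega) (by ring)

/-- **The square-integrable-carrier datum of record** at `s = p + t`: the WALL ray (`n₀ = 1`) `raySE (−(2s+1)) 1` in the `+` case `s ≤ −1`,
`rayNE (2s+1) 1` in the `−` case — Kovačević's `U(0, 2t′)`; on the locus (`s = −2` resp. `s = 1`) these are ★ `antiholDS = raySE 3 1` ∕
★ `holDS = rayNE 3 1` (`D₀ ∕ D₂` of Borel–Wallach VI 4.10). The witnesses of ★ `dsDatum`, chosen by `if`, no choice.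
[cite: Rogawski1990, §12.3 pp. 177–178] [cite: Kovacevic2021, §4 Thm. 4–5] [cite: BorelWallach2000, VI 4.10] -/
def dsDatumOfRecord (s : ℤ) : SU21Datum :=
  if s ≤ -1 then raySE (-(2 * s + 1)) 1 le_rfl (ray_constraint_one _)
  else rayNE (2 * s + 1) 1 le_rfl (ray_constraint_one _)

/-- `+` case of the `J`-datum of record (`s ≤ −1`): the north-east ladder ray. [cite: Rogawski1990, §12.3 p. 178] -/
theorem jDatumOfRecord_of_le {s : ℤ} (hs : s ≤ -1) :
    jDatumOfRecord s = rayNE (2 * s + 1) (-s) (by omega) (by ring) := dif_pos hs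

/-- `−` case of the `J`-datum of record (`s ≥ 0`): the south-east ladder ray. [cite: Rogawski1990, §12.3 p. 178] -/
theorem jDatumOfRecord_of_not_le {s : ℤ} (hs : ¬ s ≤ -1) :
    jDatumOfRecord s = raySE (-(2 * s + 1)) (s + 1) (by omega) (by ring) := dif_neg hs

/-- `+` case of the square-integrable datum of record (`s ≤ −1`): the south-east wall ray. [cite: Rogawski1990, §12.3 p. 178] -/
theorem dsDatumOfRecord_of_le {s : ℤ} (hs : s ≤ -1) :
    dsDatumOfRecord s = raySE (-(2 * s + 1)) 1 le_rfl (ray_constraint_one _) := if_pos hs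

/-- `−` case of the square-integrable datum of record (`s ≥ 0`): the north-east wall ray. [cite: Rogawski1990, §12.3 p. 178] -/
theorem dsDatumOfRecord_of_not_le {s : ℤ} (hs : ¬ s ≤ -1) :
    dsDatumOfRecord s = rayNE (2 * s + 1) 1 le_rfl (ray_constraint_one _) := if_neg hs

/-- **`jDatumOfRecord (p + t)` witnesses `sig_K2E1bJDatum` at `φ = rogTriple p q t`** (the socket body, token for token, with `𝒬` NAMED):
irreducible, unitarizable, infinitely many `K`-types, twist-integral for `e(φ) = a + b + c`, Casimir `(a² + b² + c² − 2) − e(φ)²∕3`.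
[cite: Rogawski1990, §12.3 pp. 176–178] [cite: Kovacevic2021, §3 Thm. 3; §4 Thm. 4–5] -/
theorem jDatumOfRecord_spec (p q t a b c : ℤ) (hφ : ArchSignRecipe.rogTriple p q t = (a, b, c)) :
    LieModule.IsIrreducible ℂ (Matrix (Fin 3) (Fin 3) ℂ) (jDatumOfRecord (p + t)).V ∧ IsUnitarizable (jDatumOfRecord (p + t)) ∧
      (jDatumOfRecord (p + t)).S.Infinite ∧
      (∀ n m : ℤ, (n, m) ∈ (jDatumOfRecord (p + t)).S → (6 : ℤ) ∣ m - 3 * n + 3 + 2 * (a + b + c)) ∧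
      ∀ v : (jDatumOfRecord (p + t)).V, (∑ i : Fin 3, ∑ j : Fin 3, ⁅E i j, ⁅E j i, v⁆⁆) =
        ((((a ^ 2 + b ^ 2 + c ^ 2 - 2 : ℤ) : ℂ)) - (((a + b + c : ℤ) : ℂ)) ^ 2 / 3) • v := by
  by_cases hs : p + t ≤ -1
  · rw [jDatumOfRecord_of_le hs]
    obtain ⟨hφ', h⟩ := jDatum_plus p q t hs (by omega) (by ring)
    rw [hφ] at hφ'
    simp only [Prod.mk.injEq] at hφ'
    obtain ⟨rfl, rfl, rfl⟩ := hφ'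
    exact h
  · rw [jDatumOfRecord_of_not_le hs]
    obtain ⟨hφ', h⟩ := jDatum_minus p q t hs (by omega) (by ring)
    rw [hφ] at hφ'
    simp only [Prod.mk.injEq] at hφ'
    obtain ⟨rfl, rfl, rfl⟩ := hφ'
    exact h

/-- **`dsDatumOfRecord (p + t)` witnesses `sig_K2E1bDsDatum` at `φ = rogTriple p q t`** (socket body token for token, `𝒬` NAMED), incl. the LOCUS
clause: on `rogTriple p q t = (1, 0, −1)` the datum has no `V_{2,±3}` (its `n = 2` types are `V_{2,±9}`); proof = ★ `dsDatum`'s, on the named rays.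
[cite: Kovacevic2021, §4 Thm. 4–5] [cite: BorelWallach2000, VI 4.10; Thm. 4.12 (2)] [cite: Rogawski1990, §12.3 pp. 177–178; Prop. 15.2.1 (a)] -/
theorem dsDatumOfRecord_spec (p q t a b c : ℤ) (hφ : ArchSignRecipe.rogTriple p q t = (a, b, c)) :
    LieModule.IsIrreducible ℂ (Matrix (Fin 3) (Fin 3) ℂ) (dsDatumOfRecord (p + t)).V ∧ IsUnitarizable (dsDatumOfRecord (p + t)) ∧
      (dsDatumOfRecord (p + t)).S.Infinite ∧
      (∀ n m : ℤ, (n, m) ∈ (dsDatumOfRecord (p + t)).S → (6 : ℤ) ∣ m - 3 * n + 3 + 2 * (a + b + c)) ∧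
      (∀ v : (dsDatumOfRecord (p + t)).V, (∑ i : Fin 3, ∑ j : Fin 3, ⁅E i j, ⁅E j i, v⁆⁆) =
        ((((a ^ 2 + b ^ 2 + c ^ 2 - 2 : ℤ) : ℂ)) - (((a + b + c : ℤ) : ℂ)) ^ 2 / 3) • v) ∧
      (ArchSignRecipe.IsCohTrivial p q t → ((2 : ℤ), (3 : ℤ)) ∉ (dsDatumOfRecord (p + t)).S ∧
        ((2 : ℤ), (-3 : ℤ)) ∉ (dsDatumOfRecord (p + t)).S) := by
  unfold ArchSignRecipe.rogTriple at hφ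
  by_cases hs : p + t ≤ -1
  · rw [if_pos hs] at hφ
    rw [dsDatumOfRecord_of_le hs]
    simp only [Prod.mk.injEq] at hφ
    obtain ⟨rfl, rfl, rfl⟩ := hφ
    refine ⟨isIrreducible_raySE_of_pos (-(2 * (p + t) + 1)) 1 le_rfl (ray_constraint_one _) (by omega),
      raySE_isUnitarizable (-(2 * (p + t) + 1)) 1 le_rfl (ray_constraint_one _) (by omega),
      raySE_S_infinite (-(2 * (p + t) + 1)) 1 le_rfl (ray_constraint_one _), ?_, ?_, ?_⟩
    · rintro n m ⟨-, hm⟩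
      change m = -(3 * n + (-(2 * (p + t) + 1))) at hm
      omega
    · intro v
      rw [raySE_sum_lie_lie]
      congr 1
      push_cast
      ring
    · intro hcoh
      rw [ArchSignRecipe.isCohTrivial_iff] at hcoh
      refine ⟨?_, ?_⟩
      · rintro ⟨-, hm⟩
        change (3 : ℤ) = -(3 * 2 + (-(2 * (p + t) + 1))) at hm
        omega
      · rintro ⟨-, hm⟩
        change (-3 : ℤ) = -(3 * 2 + (-(2 * (p + t) + 1))) at hm
        omega
  · rw [if_neg hs] at hφ
    rw [dsDatumOfRecord_of_not_le hs]
    simp only [Prod.mk.injEq] at hφ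
    obtain ⟨rfl, rfl, rfl⟩ := hφ
    refine ⟨isIrreducible_rayNE_of_pos (2 * (p + t) + 1) 1 le_rfl (ray_constraint_one _) (by omega),
      rayNE_isUnitarizable (2 * (p + t) + 1) 1 le_rfl (ray_constraint_one _) (by omega),
      rayNE_S_infinite (2 * (p + t) + 1) 1 le_rfl (ray_constraint_one _), ?_, ?_, ?_⟩
    · rintro n m ⟨-, hm⟩
      change m = 3 * n + (2 * (p + t) + 1) at hm
      omega
    · intro v
      rw [rayNE_sum_lie_lie]
      congr 1
      push_cast
      ring
    · intro hcoh
      rw [ArchSignRecipe.isCohTrivial_iff] at hcoh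
      refine ⟨?_, ?_⟩
      · rintro ⟨-, hm⟩
        change (3 : ℤ) = 3 * 2 + (2 * (p + t) + 1) at hm
        omega
      · rintro ⟨-, hm⟩
        change (-3 : ℤ) = 3 * 2 + (2 * (p + t) + 1) at hm
        omega

/-! ## §2  STRUCTURE — the central twist and the twisted `K`-action of record, and their package -/

/-- **The infinitesimal character `z·tr : 𝔲(2,1) →ₗ⁅ℝ⁆ ℂ`** (a Lie morphism to abelian `ℂ`: `tr ⁅X, Y⁆ = 0`, ★ `K2E1bKovLieTwist.trace_coe_lie`).
[cite: KnappVogan1995, §II.3 (2.38); Prop. 4.120] -/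
def traceCharacter (z : ℂ) : G21.lie →ₗ⁅ℝ⁆ ℂ where
  toFun X := z * (X : Matrix (Fin 2 ⊕ Fin 1) (Fin 2 ⊕ Fin 1) ℂ).trace
  map_add' X Y := by
    show z * ((X + Y : G21.lie) : Matrix (Fin 2 ⊕ Fin 1) (Fin 2 ⊕ Fin 1) ℂ).trace =
      z * (X : Matrix (Fin 2 ⊕ Fin 1) (Fin 2 ⊕ Fin 1) ℂ).trace + z * (Y : Matrix (Fin 2 ⊕ Fin 1) (Fin 2 ⊕ Fin 1) ℂ).trace
    rw [show ((X + Y : G21.lie) : Matrix (Fin 2 ⊕ Fin 1) (Fin 2 ⊕ Fin 1) ℂ) = X + Y from rfl, Matrix.trace_add, mul_add]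
  map_smul' r X := by
    show z * ((r • X : G21.lie) : Matrix (Fin 2 ⊕ Fin 1) (Fin 2 ⊕ Fin 1) ℂ).trace = r • (z * (X : Matrix (Fin 2 ⊕ Fin 1) (Fin 2 ⊕ Fin 1) ℂ).trace)
    rw [show ((r • X : G21.lie) : Matrix (Fin 2 ⊕ Fin 1) (Fin 2 ⊕ Fin 1) ℂ) = r • (X : Matrix (Fin 2 ⊕ Fin 1) (Fin 2 ⊕ Fin 1) ℂ) from rfl,
      Matrix.trace_smul, mul_smul_comm]
  map_lie' {X Y} := by
    show z * ((⁅X, Y⁆ : G21.lie) : Matrix (Fin 2 ⊕ Fin 1) (Fin 2 ⊕ Fin 1) ℂ).trace =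
      ⁅z * (X : Matrix (Fin 2 ⊕ Fin 1) (Fin 2 ⊕ Fin 1) ℂ).trace, z * (Y : Matrix (Fin 2 ⊕ Fin 1) (Fin 2 ⊕ Fin 1) ℂ).trace⁆
    rw [K2E1bKovLieTwist.trace_coe_lie, mul_zero, LieRing.of_associative_ring_bracket, mul_comm, sub_self]

/-- **The central twist of record** `σOfRecord 𝒟 e = kovLie 𝒟.ρ + (e∕3)·tr(·)·1` of a Kovačević datum by the central exponent `e`
(★ `RealMatrixGroup.twistLie`: tensoring with the infinitesimal character `(e∕3)·tr`; the centre `i·1` then acts by `i·e`).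
[cite: Rogawski1990, §12.3 p. 177] [cite: KnappVogan1995, Prop. 4.120] -/
def σOfRecord (𝒟 : SU21Datum) (e : ℤ) : G21.lie →ₗ⁅ℝ⁆ Module.End ℂ 𝒟.V :=
  RealMatrixGroup.twistLie G21 (kovLie 𝒟.ρ) (traceCharacter ((e : ℂ) / 3))

/-- `σOfRecord 𝒟 e` IS the twist of `𝒟.ρ` by `e∕3` in the sense of ★ `IsTwistOf` (definitional). [cite: Rogawski1990, §12.3 p. 177] -/
theorem σOfRecord_isTwistOf (𝒟 : SU21Datum) (e : ℤ) : IsTwistOf 𝒟.ρ ((e : ℂ) / 3) (σOfRecord 𝒟 e) :=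
  fun _ => rfl

/-- **The twisted `K`-action of record** `ρKOfRecord 𝒟 e = kTypeRepTw 𝒟.S e` (`det^{a′} u^{b′} Sym^{n−1}` on `V_{n,m}`, ★ #5).
[cite: BorelWallach2000, 0 §2.5; VI §4 4.7–4.8] -/
def ρKOfRecord (𝒟 : SU21Datum) (e : ℤ) : Representation ℂ G21.maximalCompact 𝒟.V :=
  kTypeRepTw 𝒟.S e

/-- The twisted `𝔨`-formulas hold for `σOfRecord` (★ #4). [cite: Kovacevic2021, §3 Def. 1] -/
theorem actsOnKTypesTwist_ofRecord (𝒟 : SU21Datum) (e : ℤ) : ActsOnKTypesTwist 𝒟.S e (σOfRecord 𝒟 e) :=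
  DatumTwistActs 𝒟 e _ (σOfRecord_isTwistOf 𝒟 e)

section Package

variable (𝒟 : SU21Datum) (e : ℤ) (hdiv : ∀ n m : ℤ, (n, m) ∈ 𝒟.S → (6 : ℤ) ∣ m - 3 * n + 3 + 2 * e)
include hdiv

/-- **`(ρKOfRecord, σOfRecord)` is a `(𝔲(2,1), K)`-module** when the datum is integral at `e` (★ #5 `isGKModule_kTypeRepTw` on ★ #4's formulas).
[cite: BorelWallach2000, 0 §2.5] [cite: Kovacevic2021, §3 Def. 1; §6] -/
theorem isGKModule_ofRecord : IsGKModule G21 (ρKOfRecord 𝒟 e) (σOfRecord 𝒟 e) :=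
  isGKModule_kTypeRepTw (fun n m h => ⟨𝒟.one_le_of_mem h, hdiv n m h⟩) _ (actsOnKTypesTwist_ofRecord 𝒟 e)

/-- **Irreducibility** of the structure of record for an irreducible datum (★ #9). [cite: Kovacevic2021, §3 Thm. 3] -/
theorem isIrreducibleGK_ofRecord (hirr : LieModule.IsIrreducible ℂ (Matrix (Fin 3) (Fin 3) ℂ) 𝒟.V) :
    IsIrreducibleGK (ρKOfRecord 𝒟 e) (σOfRecord 𝒟 e) :=
  TwistIrreducible 𝒟 e _ (σOfRecord_isTwistOf 𝒟 e) hirr _ (isGKModule_ofRecord 𝒟 e hdiv)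

/-- **The package `IsCohUnitaryIrrep`** of the structure of record for an irreducible unitarizable datum: `(𝔤, K)`-module (★ #4∕#5),
irreducible (★ #9), admissible (★ #6), unitary along `𝔭 ⊕ ℝz₀` (★ #8 + ★ T3a) — ★ #10's packaging with named witnesses.
[cite: Rogawski1990, §12.3 pp. 176–177] [cite: BorelWallach2000, VI Thm. 4.12 (2)] [cite: Kovacevic2021, §3 Thm. 3; §4 Thm. 4] -/
theorem isCohUnitaryIrrep_ofRecord (hirr : LieModule.IsIrreducible ℂ (Matrix (Fin 3) (Fin 3) ℂ) 𝒟.V) (hunit : IsUnitarizable 𝒟) :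
    IsCohUnitaryIrrep (ρKOfRecord 𝒟 e) (σOfRecord 𝒟 e) :=
  ⟨isGKModule_ofRecord 𝒟 e hdiv, isIrreducibleGK_ofRecord 𝒟 e hdiv hirr,
    twistAdmissible 𝒟.S e _ _ (fun _ _ h => 𝒟.one_le_of_mem h) (isGKModule_ofRecord 𝒟 e hdiv) (actsOnKTypesTwist_ofRecord 𝒟 e)
      kTypeRepTw_kvec_mem_span,
    stubT3aUnitaryAlongPOfHermitian_holds (Fin 2) (Fin 1) 𝒟.V _ (twistHermitian 𝒟 e _ (σOfRecord_isTwistOf 𝒟 e) hunit)⟩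

end Package

/-- **χ-scalars of the structure of record** (★ #7): if `Σ_{ij} E_{ij}E_{ji}` acts on `𝒟` by `κ − e²∕3` (`κ, e` integers), then `σOfRecord 𝒟 e`
has χ-scalars `(κ, e)` — trace-form Casimir `κ`, centre `i·1 ↦ e·i`. [cite: BorelWallach2000, II §2.3; II Prop. 6.12 (2)] [cite: Rogawski1990, §12.3 p. 177] -/
theorem hasChiScalars_ofRecord (𝒟 : SU21Datum) (κ e : ℤ)
    (hcas : ∀ v : 𝒟.V, (∑ i : Fin 3, ∑ j : Fin 3, ⁅E i j, ⁅E j i, v⁆⁆) = (((κ : ℤ) : ℂ) - ((e : ℤ) : ℂ) ^ 2 / 3) • v) :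
    HasChiScalars (σOfRecord 𝒟 e) κ e := by
  obtain ⟨hC, hZ⟩ := twistChiScalars 𝒟 e _ hcas _ (σOfRecord_isTwistOf 𝒟 e)
  refine ⟨fun v => ?_, hZ⟩
  rw [hC v, sub_add_cancel]

/-! ## §3  CLASSES — the bundles, their classes, the χ-pins, the locus clause, the table -/

/-- §1's integrality ∕ Casimir clauses in the tier-0 exponents `centralExp` ∕ `casimirExp` (`J`-datum). [cite: Rogawski1990, §12.3 pp. 176–178] -/
theorem jDatumOfRecord_exps (p q t : ℤ) :
    (∀ n m : ℤ, (n, m) ∈ (jDatumOfRecord (p + t)).S → (6 : ℤ) ∣ m - 3 * n + 3 + 2 * centralExp p q t) ∧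
      ∀ v : (jDatumOfRecord (p + t)).V, (∑ i : Fin 3, ∑ j : Fin 3, ⁅E i j, ⁅E j i, v⁆⁆) =
        ((((casimirExp p q t : ℤ) : ℂ)) - (((centralExp p q t : ℤ) : ℂ)) ^ 2 / 3) • v := by
  obtain ⟨⟨a, b, c⟩, habc⟩ : ∃ abc : ℤ × ℤ × ℤ, ArchSignRecipe.rogTriple p q t = abc := ⟨_, rfl⟩
  obtain ⟨-, -, -, hint, hcas⟩ := jDatumOfRecord_spec p q t a b c habc
  simp only [centralExp, casimirExp, habc]
  exact ⟨hint, hcas⟩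

/-- The integrality and Casimir clauses of §1 read in the tier-0 exponents (square-integrable datum). [cite: Rogawski1990, §12.3 pp. 177–178] -/
theorem dsDatumOfRecord_exps (p q t : ℤ) :
    (∀ n m : ℤ, (n, m) ∈ (dsDatumOfRecord (p + t)).S → (6 : ℤ) ∣ m - 3 * n + 3 + 2 * centralExp p q t) ∧
      ∀ v : (dsDatumOfRecord (p + t)).V, (∑ i : Fin 3, ∑ j : Fin 3, ⁅E i j, ⁅E j i, v⁆⁆) =
        ((((casimirExp p q t : ℤ) : ℂ)) - (((centralExp p q t : ℤ) : ℂ)) ^ 2 / 3) • v := by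
  obtain ⟨⟨a, b, c⟩, habc⟩ : ∃ abc : ℤ × ℤ × ℤ, ArchSignRecipe.rogTriple p q t = abc := ⟨_, rfl⟩
  obtain ⟨-, -, -, hint, hcas, -⟩ := dsDatumOfRecord_spec p q t a b c habc
  simp only [centralExp, casimirExp, habc]
  exact ⟨hint, hcas⟩

/-- **The `J`-carrier of record at `φ = rogTriple p q t`, bundled**: Kovačević's ladder ray `jDatumOfRecord (p + t)` with the twisted
`K`-action and the central twist by `e(φ) = centralExp p q t` — an irreducible `(𝔲(2,1), K)`-module (LEVEL A name for `πⁿ(ξ_ι) = J^{±}_φ`).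
[cite: Rogawski1990, §12.3 p. 178] [cite: Kovacevic2021, §4 Thm. 4–5] -/
def jRepOfRecord (p q t : ℤ) : GKIrrep G21 :=
  ⟨(jDatumOfRecord (p + t)).V, ρKOfRecord (jDatumOfRecord (p + t)) (centralExp p q t), σOfRecord (jDatumOfRecord (p + t)) (centralExp p q t),
    isGKModule_ofRecord _ _ (jDatumOfRecord_exps p q t).1,
    isIrreducibleGK_ofRecord _ _ (jDatumOfRecord_exps p q t).1 (jDatumOfRecord_spec p q t _ _ _ rfl).1⟩

/-- **The square-integrable carrier of record at `φ = rogTriple p q t`, bundled**: the wall ray `dsDatumOfRecord (p + t)` with the twisted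
`K`-action and the central twist by `e(φ)` (LEVEL A name for `πˢ(ξ_ι)`; on the locus the discrete series `D₀ ∕ D₂`).
[cite: Rogawski1990, §12.3 pp. 177–178] [cite: Kovacevic2021, §4 Thm. 4–5] -/
def dsRepOfRecord (p q t : ℤ) : GKIrrep G21 :=
  ⟨(dsDatumOfRecord (p + t)).V, ρKOfRecord (dsDatumOfRecord (p + t)) (centralExp p q t), σOfRecord (dsDatumOfRecord (p + t)) (centralExp p q t),
    isGKModule_ofRecord _ _ (dsDatumOfRecord_exps p q t).1,
    isIrreducibleGK_ofRecord _ _ (dsDatumOfRecord_exps p q t).1 (dsDatumOfRecord_spec p q t _ _ _ rfl).1⟩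

/-- **`jInfOfRecord p q t`** — the CLASS of the `J`-carrier of record (★ `GKIrrClass.mk`). [cite: Rogawski1990, §12.3 p. 178] -/
def jInfOfRecord (p q t : ℤ) : GKIrrClass G21 :=
  GKIrrClass.mk (jRepOfRecord p q t)

/-- **`dsInfOfRecord p q t`** — the CLASS of the square-integrable carrier of record. [cite: Rogawski1990, §12.3 pp. 177–178] -/
def dsInfOfRecord (p q t : ℤ) : GKIrrClass G21 :=
  GKIrrClass.mk (dsRepOfRecord p q t)

/-- **The `J`-carrier of record is coh-unitary irreducible with χ-scalars `(κ(φ), e(φ))`** (representative = the bundle itself).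
[cite: Rogawski1990, §12.3 pp. 176–178] [cite: BorelWallach2000, VI Thm. 4.12 (2)] [cite: Kovacevic2021, §4 Thm. 4–5] -/
theorem jRepOfRecord_package (p q t : ℤ) :
    IsCohUnitaryIrrep (jRepOfRecord p q t).ρK (jRepOfRecord p q t).ρ𝔤 ∧
      HasChiScalars (jRepOfRecord p q t).ρ𝔤 (casimirExp p q t) (centralExp p q t) :=
  have h := jDatumOfRecord_spec p q t _ _ _ rfl
  ⟨isCohUnitaryIrrep_ofRecord _ _ (jDatumOfRecord_exps p q t).1 h.1 h.2.1,
    hasChiScalars_ofRecord _ _ _ (jDatumOfRecord_exps p q t).2⟩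

/-- **The square-integrable carrier of record is coh-unitary irreducible with χ-scalars `(κ(φ), e(φ))`.**
[cite: Rogawski1990, §12.3 pp. 177–178] [cite: BorelWallach2000, VI Thm. 4.12 (2)] [cite: Kovacevic2021, §4 Thm. 4–5] -/
theorem dsRepOfRecord_package (p q t : ℤ) :
    IsCohUnitaryIrrep (dsRepOfRecord p q t).ρK (dsRepOfRecord p q t).ρ𝔤 ∧
      HasChiScalars (dsRepOfRecord p q t).ρ𝔤 (casimirExp p q t) (centralExp p q t) :=
  have h := dsDatumOfRecord_spec p q t _ _ _ rfl
  ⟨isCohUnitaryIrrep_ofRecord _ _ (dsDatumOfRecord_exps p q t).1 h.1 h.2.1,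
    hasChiScalars_ofRecord _ _ _ (dsDatumOfRecord_exps p q t).2⟩

/-- **χ-PIN of the `J`-class of record**: `IsChiPinnedCohUnitary (jInfOfRecord p q t) (casimirExp p q t) (centralExp p q t)` — field `jInf_chi`
of ★ `ArchPacketTable`. [cite: Rogawski1990, §12.3 pp. 176–178] -/
theorem jInfOfRecord_chi (p q t : ℤ) : IsChiPinnedCohUnitary (jInfOfRecord p q t) (casimirExp p q t) (centralExp p q t) :=
  ⟨jRepOfRecord p q t, rfl, jRepOfRecord_package p q t⟩

/-- **χ-PIN of the square-integrable class of record** — field `dsInf_chi` of ★ `ArchPacketTable`. [cite: Rogawski1990, §12.3 p. 177] -/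
theorem dsInfOfRecord_chi (p q t : ℤ) : IsChiPinnedCohUnitary (dsInfOfRecord p q t) (casimirExp p q t) (centralExp p q t) :=
  ⟨dsRepOfRecord p q t, rfl, dsRepOfRecord_package p q t⟩

/-- **Zero-twist bridge** (K2E1b-plan's cert, verbatim): at `(e : ℂ) = 0` the twisted `𝔨`-formulas ARE ★ `ActsOnKTypes`. [cite: Kovacevic2021, §3 Def. 1] -/
theorem actsOnKTypes_of_twist_zero {S : Set (ℤ × ℤ)} {e : ℤ}
    {ρ𝔤 : (uFormGroup (Fin 2) (Fin 1)).lie →ₗ⁅ℝ⁆ Module.End ℂ (KIdx S →₀ ℂ)} (he : (e : ℂ) = 0)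
    (h : ActsOnKTypesTwist S e ρ𝔤) : ActsOnKTypes S ρ𝔤 := by
  intro X n m k hS hk hkn
  have := h X n m k hS hk hkn
  rw [he, zero_div, zero_mul, zero_smul, add_zero] at this
  exact this

/-- On the locus the central exponent vanishes: `rogTriple p q t = (1, 0, −1) ⇒ centralExp p q t = 0`. [cite: Rogawski1990, §12.3 p. 178] -/
theorem centralExp_eq_zero_of_isCohTrivial {p q t : ℤ} (h : ArchSignRecipe.IsCohTrivial p q t) : centralExp p q t = 0 := by
  unfold ArchSignRecipe.IsCohTrivial at h
  simp only [centralExp, h]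
  norm_num

/-- **LOCUS CLAUSE of the square-integrable class of record** — field `dsInf_locus` of ★ `ArchPacketTable`: on `φ = (1, 0, −1)` EVERY irreducible
module of class `dsInfOfRecord p q t` has `H¹_{±1} = 0`.  On the locus `e = 0`, so `σOfRecord` acts on `𝔨` by the UNTWISTED formulas
(`actsOnKTypes_of_twist_zero`); the wall ray has no `𝔭`-type `V_{2,±3}` (§1), hence no non-zero `K`-equivariant `1`-cocycle of type `±1`
(★ #14 `NoDegOneOfNoPTypes`: `H¹ = Hom_K(𝔭, V)` needs a `V_{2,±3}`); ★ #15 `typeClassesBotTransport` carries `= ⊥` to every module of the class.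
[cite: Rogawski1990, Prop. 15.2.1 (a) p. 249] [cite: BorelWallach2000, VI Thm. 4.11 (2); I Thm. 5.3] -/
theorem dsInfOfRecord_locus (p q t : ℤ) (hct : ArchSignRecipe.IsCohTrivial p q t) : NoDegOneClass (dsInfOfRecord p q t) := by
  intro M _ _ σK σ𝔤 hM hirr hMx δ _
  have he : ((centralExp p q t : ℤ) : ℂ) = 0 := by
    rw [centralExp_eq_zero_of_isCohTrivial hct, Int.cast_zero]
  obtain ⟨h23, h2m3⟩ := (dsDatumOfRecord_spec p q t _ _ _ rfl).2.2.2.2.2 hct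
  have hbot : upqTypeClasses (dsRepOfRecord p q t).ρK (dsRepOfRecord p q t).ρ𝔤 (dsRepOfRecord p q t).isGKModule.ad_compat 1 δ = ⊥ :=
    NoDegOneOfNoPTypes (dsDatumOfRecord (p + t)).S _ _ (dsRepOfRecord p q t).isGKModule
      (fun _ _ h => (dsDatumOfRecord (p + t)).one_le_of_mem h)
      (actsOnKTypes_of_twist_zero he (actsOnKTypesTwist_ofRecord (dsDatumOfRecord (p + t)) (centralExp p q t))) h23 h2m3 δ
  exact typeClassesBotTransport (dsRepOfRecord p q t) ⟨M, σK, σ𝔤, hM, hirr⟩ hMx.symm 1 δ hbot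

/-- **THE TABLE OF RECORD** — an inhabitant of the posited interface ★ `ArchPacketTable` (tier 0, LEVEL A) BY NAME: `jInf := jInfOfRecord`,
`dsInf := dsInfOfRecord` (both `rfl`), with the χ-pins and the locus clause of §3.  (Existence = the tier-0 stubs «J-TABLE» ∕ «DS-TABLE»; this NAMES it.)
[cite: Rogawski1990, §12.3 pp. 176–178; Prop. 15.2.1 (a) p. 249] [cite: BorelWallach2000, VI Thm. 4.11 (2)] -/
def tableOfRecord : ArchPacketTable :=
  ⟨jInfOfRecord, dsInfOfRecord, jInfOfRecord_chi, dsInfOfRecord_chi, dsInfOfRecord_locus⟩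

end Summit.HodgeConjecture.HodgeConjecture.Cruxes.H413.K2E1bCarriersOfRecord

end
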